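import Literature.NumberTheory.Automorphic.Liu2021.RemD5CompanionAdmissibility
import Literature.NumberTheory.Automorphic.Liu2021.RemD5CompanionParity
import Literature.NumberTheory.QuadraticForms.LocalNormIndex
import HarnessLib

/-!
# [Liu2021, Lem. D.1 (4)] «`ε′ ≠ ε` when `V` is anisotropic»: the local norm-class group at such a place has two elements,
# the flipped collection exists, and the Case-B companion admissibility follows

Topic `NumberTheory/Automorphic/Liu2021`; namespace `Literature.NumberTheory.Automorphic.Liu2021.RemD5`.  KERNEL ONLY: theorems,
no definition, no named fact, no `sorry`; orientation-free; no text of [Liu2021, Rem. D.5] is stated or consumed.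

[Liu2021, Lem. D.1 (4) (l. 5235)]: at `n = 2`, `ω(μ′,ε′,χ′) ≅ ω(μ,ε,χ)` iff `(μ′,ε′,χ′) = (μ,ε,χ)` or `μ′ = μᶜχ̌`, `χ′ = χ`, and
`ε′ = ε` (resp. `ε′ ≠ ε`) when `V` is isotropic (resp. anisotropic) — `ε, ε′ ∈ E_v^{−×}/N E_v^×`, a group with TWO elements when
`E_v` is a field ([Omeara1963, 63:13a]).  In the tree's currency (`Def411WeilCarriers.Eps F d = Π_v F_vˣ ⧸ N(F_v(√d)ˣ)`):

* §1 `mul_ne_one_iff_eq_one_of_card_eq_two`, `exists_ne_one_of_card_eq_two` — two-element groups;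
  **`natCard_normClassGroup_eq_two`** — for `d` a non-square in `F_v`, `F_vˣ ⧸ N(F_v(√d)ˣ)` has exactly two elements
  (★ `QuadraticForms.index_quadraticNormSubgroup_adicCompletion_eq_two`); **`ne_iff_flip_of_not_isSquare`** — there «`ε′_v ≠ ε_v`» is
  the flip condition «`ε′_v ≠ 1 ↔ ε_v = 1`» of ★ `RemD5CompanionAdmissibility`;
* §2 **`not_isSquare_of_not_isIsotropic`** — at an ANISOTROPIC place of the hermitian plane `diag(t₀,t₁) ⊗ 1` (★ p751016
  `not_isIsotropic_standingData_iff_hilbertSymbol_eq_neg_one`) `d = δ²` is a non-square in `F_v`; **`exists_eps_flip`** — for every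
  `T ⊆ {v : d non-square}` a collection `ε′` with `ε′ = ε` off `T` and `ε′ ≠ ε` on `T` EXISTS;
* §3 **`not_isAdmissible_companion_of_ne_on_anisotropic`** / **`isAdmissible_flip_companion_of_ne_on_anisotropic`** — the Case-B companion
  statements of ★ `RemD5CompanionAdmissibility` with `T :=` the anisotropic set of the registered frame `diag dJ` (finite, ★ p751016;
  parity `[F⁺:ℚ] − 1`, ★ p751708 from the registered signature clause `_hsig`) and `ε′` ANY collection differing from `ε` exactly on `T`.

Consumer: `Cruxes/HLiu418/Lines/d6_cm_curve` `stub_S1b` Case B (census `CENSUS-S1b-CaseB-relabel.A-p03g11.md` d861c608 §4): next run's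
[Rem. D.5] text receives ONE arithmetic statement.  HC_CM is proved only modulo the 7 printed citations until rung 0 closes; this file
proves no cell binder.

## References
* [Liu2021] Y. Liu, Camb. J. Math. 9 (2021) = arXiv:2102.11518: Lem. D.1 (4) (l. 5235), Def. 4.12 (l. 2102–2108), App. D §D.3 (l. 5355).
* [Omeara1963] O. T. O'Meara, *Introduction to Quadratic Forms* (1963), §63B Cor. 63:13a, §71 Thm. 71:18.
-/

set_option autoImplicit false

noncomputable section

open scoped Matrix MatrixGroups ComplexOrder
open NumberField IsDedekindDomain
open Literature.AlgebraicGeometry.Liu2021 (IsAdmissibleElement)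
open Literature.AlgebraicGeometry.Motives (CMType)
open Literature.NumberTheory.ComplexMultiplication (CMTypeOps.bar CMTypeOps.flip)
open Literature.NumberTheory.QuadraticForms (quadraticNormSubgroup hilbertSymbol)
open Literature.NumberTheory.Automorphic.UnitaryGroup

namespace Literature.NumberTheory.Automorphic.Liu2021.RemD5

/-! ## §1 Two-element groups; the local norm-class group at a place where `d` is a non-square -/

/-- In a group with exactly two elements, for `c ≠ 1`: `x · c ≠ 1 ↔ x = 1`. [folklore] [cite: Omeara1963, §63B Cor. 63:13a] -/
theorem mul_ne_one_iff_eq_one_of_card_eq_two {Q : Type*} [Group Q] (h : Nat.card Q = 2) {c : Q} (hc : c ≠ 1) (x : Q) :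
    x * c ≠ 1 ↔ x = 1 := by
  obtain ⟨c', hc', huniq⟩ := (Nat.card_eq_two_iff' (1 : Q)).1 h
  have hcc' : c = c' := huniq c hc
  have key : ∀ y : Q, y = 1 ∨ y = c := fun y => by
    by_cases hy : y = 1
    · exact Or.inl hy
    · exact Or.inr (hcc' ▸ huniq y hy)
  have hc2 : c * c = 1 := by
    rcases key (c * c) with h2 | h2
    · exact h2
    · exact absurd (mul_left_cancel (h2.trans (mul_one c).symm)) hc
  constructor
  · intro hx
    rcases key x with h1 | h1
    · exact h1
    · exact (hx (by rw [h1, hc2])).elim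
  · rintro rfl
    rwa [one_mul]

/-- A group with exactly two elements has an element `≠ 1`. [folklore] [cite: Omeara1963, §63B Cor. 63:13a] -/
theorem exists_ne_one_of_card_eq_two {Q : Type*} [Group Q] (h : Nat.card Q = 2) : ∃ c : Q, c ≠ 1 := by
  obtain ⟨c, hc, -⟩ := (Nat.card_eq_two_iff' (1 : Q)).1 h
  exact ⟨c, hc⟩

variable {F : Type} [Field F] [NumberField F]

/-- **[Omeara1963, 63:13a] in the tree's `Eps` currency**: for `d` a non-square in `F_v`, the local norm-class group
`F_vˣ ⧸ N(F_v(√d)ˣ)` has exactly TWO elements. [cite: Omeara1963, §63B Cor. 63:13a] [cite: Liu2021, Lem. D.1 (4) (l. 5235)] -/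
theorem natCard_normClassGroup_eq_two (v : HeightOneSpectrum (𝓞 F)) (d : F)
    (hns : ¬ IsSquare (algebraMap F (v.adicCompletion F) d)) :
    Nat.card ((v.adicCompletion F)ˣ ⧸ quadraticNormSubgroup (v.adicCompletion F) (algebraMap F (v.adicCompletion F) d)) = 2 := by
  have hd0 : algebraMap F (v.adicCompletion F) d ≠ 0 := fun h => hns ⟨0, by rw [h, mul_zero]⟩
  rw [← Subgroup.index_eq_card]
  exact QuadraticForms.index_quadraticNormSubgroup_adicCompletion_eq_two F v hd0 hns

/-- **«`ε′_v ≠ ε_v`» is the flip condition** at a place where `d` is a non-square: `ε′_v ≠ ε_v ↔ (ε′_v ≠ 1 ↔ ε_v = 1)`.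
[cite: Liu2021, Lem. D.1 (4) (l. 5235)] [cite: Omeara1963, §63B Cor. 63:13a] -/
theorem ne_iff_flip_of_not_isSquare (v : HeightOneSpectrum (𝓞 F)) (d : F)
    (hns : ¬ IsSquare (algebraMap F (v.adicCompletion F) d))
    (x y : (v.adicCompletion F)ˣ ⧸ quadraticNormSubgroup (v.adicCompletion F) (algebraMap F (v.adicCompletion F) d)) :
    y ≠ x ↔ (y ≠ 1 ↔ x = 1) := by
  have h2 := natCard_normClassGroup_eq_two v d hns
  -- `y = x * (x⁻¹ * y)`
  by_cases hc : x⁻¹ * y = 1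
  · have hxy : y = x := by rw [← mul_one x, ← hc, mul_inv_cancel_left]
    subst hxy
    simp
  · have key := mul_ne_one_iff_eq_one_of_card_eq_two h2 hc x
    rw [mul_inv_cancel_left] at key
    constructor
    · intro _; exact key
    · intro _ hyx
      apply hc
      rw [hyx, inv_mul_cancel]

/-! ## §2 Anisotropic places: `d` is a non-square; the flipped collection exists -/

/-- **At an anisotropic place of the plane `diag(t₀,t₁) ⊗ 1`, `d = δ²` is a non-square in `F_v`** (if `d` were a square the
Hilbert symbol `(d, −t₀t₁)_v` would be `1`, ★ p751016). [cite: Liu2021, Lem. D.1 (4) (l. 5235)] [cite: Omeara1963, §63B] -/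
theorem not_isSquare_of_not_isIsotropic (E : Type) [Field E] [NumberField E] [Algebra F E] [Algebra.IsQuadraticExtension F E]
    (v : HeightOneSpectrum (𝓞 F)) (c : E ≃ₐ[F] E) {δ : E} (hcδ : c δ = -δ) (hδ : δ ≠ 0) (t : Fin 2 → F)
    {J : Matrix (Fin 2) (Fin 2) E} (hJ : J = (Matrix.diagonal t).map (algebraMap F E)) (hJh : (J.map c)ᵀ = J) (hJdet : J.det ≠ 0)
    {d : F} (hd : δ * δ = algebraMap F E d) (ht : ∀ i, t i ≠ 0)
    (hv : ¬ LemD1.IsIsotropic (LemD1OfPlace.standingData E v c 2 J hcδ hδ le_rfl hJh hJdet)) :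
    ¬ IsSquare (algebraMap F (v.adicCompletion F) d) := by
  intro hsq
  have hd0 : algebraMap F (v.adicCompletion F) d ≠ 0 := by
    intro h
    have : d = 0 := (map_eq_zero _).1 h
    rw [this, map_zero, mul_self_eq_zero] at hd
    exact hδ hd
  have h1 := (LemD1OfPlace.not_isIsotropic_standingData_iff_hilbertSymbol_eq_neg_one E v c hcδ hδ t hJ hJh hJdet hd ht).1 hv
  rw [QuadraticForms.hilbertSymbol_eq_one_of_isSquare hsq hd0] at h1
  norm_num at h1

/-- **The flipped collection exists**: for `T ⊆ {v : d is a non-square in F_v}` there is `ε′` with `ε′ = ε` off `T` and `ε′ ≠ ε` on `T`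
(multiply by the non-trivial local class on `T`). [cite: Liu2021, Lem. D.1 (4) (l. 5235)] [cite: Omeara1963, §63B Cor. 63:13a] -/
theorem exists_eps_flip (d : F) (ε : Def411WeilCarriers.Eps F d) (T : Set (HeightOneSpectrum (𝓞 F)))
    (hT : ∀ v ∈ T, ¬ IsSquare (algebraMap F (v.adicCompletion F) d)) :
    ∃ ε' : Def411WeilCarriers.Eps F d, (∀ v ∉ T, ε' v = ε v) ∧ ∀ v ∈ T, ε' v ≠ ε v := by
  classical
  have hc : ∀ v : HeightOneSpectrum (𝓞 F), ∃ c : (v.adicCompletion F)ˣ ⧸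
      quadraticNormSubgroup (v.adicCompletion F) (algebraMap F (v.adicCompletion F) d), v ∈ T → c ≠ 1 := by
    intro v
    by_cases hv : v ∈ T
    · obtain ⟨c, hc⟩ := exists_ne_one_of_card_eq_two (natCard_normClassGroup_eq_two v d (hT v hv))
      exact ⟨c, fun _ => hc⟩
    · exact ⟨1, fun h => (hv h).elim⟩
  choose c hc using hc
  refine ⟨fun v => if v ∈ T then ε v * c v else ε v, fun v hv => by simp [hv], fun v hv => ?_⟩
  show (if v ∈ T then ε v * c v else ε v) ≠ ε v
  rw [if_pos hv]
  intro h
  exact hc v hv (by rw [← inv_mul_cancel_left (ε v) (c v), h, inv_mul_cancel])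

/-- … and ANY `ε′` differing from `ε` exactly on such a `T` satisfies the flip hypotheses of ★ `RemD5CompanionAdmissibility`.
[cite: Liu2021, Lem. D.1 (4) (l. 5235)] -/
theorem flip_hypotheses_of_ne_on (d : F) (ε ε' : Def411WeilCarriers.Eps F d) (T : Set (HeightOneSpectrum (𝓞 F)))
    (hT : ∀ v ∈ T, ¬ IsSquare (algebraMap F (v.adicCompletion F) d)) (hon : ∀ v ∈ T, ε' v ≠ ε v) :
    ∀ v ∈ T, ε' v ≠ 1 ↔ ε v = 1 := fun v hv =>
  (ne_iff_flip_of_not_isSquare v d (hT v hv) (ε v) (ε' v)).1 (hon v hv)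

/-! ## §3 The Case-B companion statements on the anisotropic set of the registered frame -/

variable {L : Type} [Field L] [NumberField L] [IsCMField L]

/-- **Companion type never admissible, on the anisotropic set.**  Registered-frame data: `ι₁`, `dJ` real diagonal with the signature
clause `hsig` (`(1,1)` at `ι₁`, definite elsewhere), `δ₁` purely imaginary with `δ₁² = d` (the `Eps` parameter), `δ` the (any) purely
imaginary normaliser of `epsOf`; `T := {v : (F_v², diag dJ ⊗ 1) anisotropic}`; `ε′` ANY collection equal to `ε` off `T` and different on `T`.
Then from the pinned admissibility of `ε` for `Φ`, the CONJUGATE type `Φ̄` is not admissible for `ε′` (★ p751016 + ★ p751708 + ★ p754629).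
[cite: Liu2021, Lem. D.1 (4) (l. 5235); Def. 4.12 (l. 2102–2108); App. D §D.3 (l. 5355)] [cite: Omeara1963, §71 Thm. 71:18] -/
theorem not_isAdmissible_companion_of_ne_on_anisotropic (Φ : CMType L) (ι₁ : L →+* ℂ) (dJ : Fin 2 → L)
    (hdJ : ∀ i, IsCMField.complexConj L (dJ i) = dJ i) (hdJ0 : ∀ i, dJ i ≠ 0)
    (hsig : (∃ Tstar : GL (Fin 2) ℂ,
        formCongr (starRingEnd ℂ) Tstar ((Matrix.diagonal dJ).map ι₁) = Matrix.diagonal ![(1 : ℂ), -1]) ∧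
      ∀ τ' : L →+* ℂ, InfinitePlace.mk τ' ≠ InfinitePlace.mk ι₁ → ((Matrix.diagonal dJ).map τ').PosDef)
    {δ₁ : L} (hcδ₁ : IsCMField.complexConj L δ₁ = -δ₁) (hδ₁ : δ₁ ≠ 0)
    (hJh : ((Matrix.diagonal dJ).map (IsCMField.complexConj L))ᵀ = Matrix.diagonal dJ) (hJdet : (Matrix.diagonal dJ).det ≠ 0)
    (d : maximalRealSubfield L) (hd : δ₁ * δ₁ = algebraMap (maximalRealSubfield L) L d)
    {δ : L} (hδ : IsCMField.complexConj L δ = -δ) (hδ0 : δ ≠ 0)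
    (ε ε' : Def411WeilCarriers.Eps (maximalRealSubfield L) d)
    (hoff : ∀ v, LemD1.IsIsotropic (LemD1OfPlace.standingData L v (IsCMField.complexConj L) 2 (Matrix.diagonal dJ) hcδ₁ hδ₁ le_rfl
      hJh hJdet) → ε' v = ε v)
    (hon : ∀ v, ¬ LemD1.IsIsotropic (LemD1OfPlace.standingData L v (IsCMField.complexConj L) 2 (Matrix.diagonal dJ) hcδ₁ hδ₁ le_rfl
      hJh hJdet) → ε' v ≠ ε v)
    (hadm : ∃ e : L, IsAdmissibleElement L Φ.1 e ∧ Def411WeilCarriers.epsOf (maximalRealSubfield L) d L δ (-e) = ε) :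
    ¬ ∃ e : L, IsAdmissibleElement L (CMTypeOps.bar Φ).1 e ∧ Def411WeilCarriers.epsOf (maximalRealSubfield L) d L δ (-e) = ε' := by
  -- the real diagonal `t` with `diag dJ = diag t ⊗ 1`
  let t : Fin 2 → maximalRealSubfield L := fun i => ⟨dJ i, (IsCMField.complexConj_eq_self_iff (K := L) (dJ i)).1 (hdJ i)⟩
  have hJ : Matrix.diagonal dJ = (Matrix.diagonal t).map (algebraMap (maximalRealSubfield L) L) := by
    rw [Matrix.diagonal_map (map_zero _)]; rfl
  have ht : ∀ i, t i ≠ 0 := fun i h => hdJ0 i (congrArg Subtype.val h)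
  set T : Set (HeightOneSpectrum (𝓞 (maximalRealSubfield L))) := {v | ¬ LemD1.IsIsotropic
    (LemD1OfPlace.standingData L v (IsCMField.complexConj L) 2 (Matrix.diagonal dJ) hcδ₁ hδ₁ le_rfl hJh hJdet)} with hTdef
  have hTfin : T.Finite :=
    LemD1OfPlace.finite_setOf_not_isIsotropic L (IsCMField.complexConj L) hcδ₁ hδ₁ t hJ hJh hJdet hd ht
  have hpar : Even (T.ncard + (Module.finrank ℚ (maximalRealSubfield L) - 1)) :=
    even_ncard_not_isIsotropic_add_finrank_sub_one L ι₁ dJ hdJ hdJ0 hsig hcδ₁ hδ₁ hJh hJdet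
  have hns : ∀ v ∈ T, ¬ IsSquare (algebraMap (maximalRealSubfield L) (v.adicCompletion (maximalRealSubfield L)) d) := fun v hv =>
    not_isSquare_of_not_isIsotropic L v (IsCMField.complexConj L) hcδ₁ hδ₁ t hJ hJh hJdet hd ht hv
  have hd0 : d ≠ 0 := fun h => by
    rw [h, map_zero, mul_self_eq_zero] at hd; exact hδ₁ hd
  have hdneg : ∀ (w : InfinitePlace (maximalRealSubfield L)) (hw : w.IsReal), InfinitePlace.embedding_of_isReal hw d < 0 :=
    fun w hw => embedding_of_isReal_lt_zero_of_coe_eq_mul_self hcδ₁ hδ₁ hd.symm w hw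
  exact not_isAdmissible_companion_of_flip Φ hδ hδ0 d hd0 hdneg ε ε' hTfin (fun v hv => hoff v (by simpa [hTdef] using hv))
    (flip_hypotheses_of_ne_on (d : maximalRealSubfield L) ε ε' T hns (fun v hv => hon v hv)) hpar hadm

/-- **Flipped companion type admissible, on the anisotropic set** — the companion half of Case B: under the same data, `ε′` IS admissible
(pinned currency) for `flip ι₁ Φ̄`. [cite: Liu2021, Lem. D.1 (4) (l. 5235); Def. 4.12 (l. 2102–2108); App. D §D.3 (l. 5355)] [cite: Omeara1963, §71 Thm. 71:19] -/
theorem isAdmissible_flip_companion_of_ne_on_anisotropic (Φ : CMType L) (ι₁ : L →+* ℂ) (dJ : Fin 2 → L)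
    (hdJ : ∀ i, IsCMField.complexConj L (dJ i) = dJ i) (hdJ0 : ∀ i, dJ i ≠ 0)
    (hsig : (∃ Tstar : GL (Fin 2) ℂ,
        formCongr (starRingEnd ℂ) Tstar ((Matrix.diagonal dJ).map ι₁) = Matrix.diagonal ![(1 : ℂ), -1]) ∧
      ∀ τ' : L →+* ℂ, InfinitePlace.mk τ' ≠ InfinitePlace.mk ι₁ → ((Matrix.diagonal dJ).map τ').PosDef)
    {δ₁ : L} (hcδ₁ : IsCMField.complexConj L δ₁ = -δ₁) (hδ₁ : δ₁ ≠ 0)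
    (hJh : ((Matrix.diagonal dJ).map (IsCMField.complexConj L))ᵀ = Matrix.diagonal dJ) (hJdet : (Matrix.diagonal dJ).det ≠ 0)
    (d : maximalRealSubfield L) (hd : δ₁ * δ₁ = algebraMap (maximalRealSubfield L) L d)
    {δ : L} (hδ : IsCMField.complexConj L δ = -δ) (hδ0 : δ ≠ 0)
    (ε ε' : Def411WeilCarriers.Eps (maximalRealSubfield L) d)
    (hoff : ∀ v, LemD1.IsIsotropic (LemD1OfPlace.standingData L v (IsCMField.complexConj L) 2 (Matrix.diagonal dJ) hcδ₁ hδ₁ le_rfl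
      hJh hJdet) → ε' v = ε v)
    (hon : ∀ v, ¬ LemD1.IsIsotropic (LemD1OfPlace.standingData L v (IsCMField.complexConj L) 2 (Matrix.diagonal dJ) hcδ₁ hδ₁ le_rfl
      hJh hJdet) → ε' v ≠ ε v)
    (hadm : ∃ e : L, IsAdmissibleElement L Φ.1 e ∧ Def411WeilCarriers.epsOf (maximalRealSubfield L) d L δ (-e) = ε) :
    ∃ e : L, IsAdmissibleElement L (CMTypeOps.flip ι₁ (CMTypeOps.bar Φ)).1 e ∧
      Def411WeilCarriers.epsOf (maximalRealSubfield L) d L δ (-e) = ε' := by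
  let t : Fin 2 → maximalRealSubfield L := fun i => ⟨dJ i, (IsCMField.complexConj_eq_self_iff (K := L) (dJ i)).1 (hdJ i)⟩
  have hJ : Matrix.diagonal dJ = (Matrix.diagonal t).map (algebraMap (maximalRealSubfield L) L) := by
    rw [Matrix.diagonal_map (map_zero _)]; rfl
  have ht : ∀ i, t i ≠ 0 := fun i h => hdJ0 i (congrArg Subtype.val h)
  set T : Set (HeightOneSpectrum (𝓞 (maximalRealSubfield L))) := {v | ¬ LemD1.IsIsotropic
    (LemD1OfPlace.standingData L v (IsCMField.complexConj L) 2 (Matrix.diagonal dJ) hcδ₁ hδ₁ le_rfl hJh hJdet)} with hTdef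
  have hTfin : T.Finite :=
    LemD1OfPlace.finite_setOf_not_isIsotropic L (IsCMField.complexConj L) hcδ₁ hδ₁ t hJ hJh hJdet hd ht
  have hpar : Even (T.ncard + (Module.finrank ℚ (maximalRealSubfield L) - 1)) :=
    even_ncard_not_isIsotropic_add_finrank_sub_one L ι₁ dJ hdJ hdJ0 hsig hcδ₁ hδ₁ hJh hJdet
  have hns : ∀ v ∈ T, ¬ IsSquare (algebraMap (maximalRealSubfield L) (v.adicCompletion (maximalRealSubfield L)) d) := fun v hv =>
    not_isSquare_of_not_isIsotropic L v (IsCMField.complexConj L) hcδ₁ hδ₁ t hJ hJh hJdet hd ht hv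
  have hd0 : d ≠ 0 := fun h => by
    rw [h, map_zero, mul_self_eq_zero] at hd; exact hδ₁ hd
  have hdneg : ∀ (w : InfinitePlace (maximalRealSubfield L)) (hw : w.IsReal), InfinitePlace.embedding_of_isReal hw d < 0 :=
    fun w hw => embedding_of_isReal_lt_zero_of_coe_eq_mul_self hcδ₁ hδ₁ hd.symm w hw
  exact isAdmissible_flip_companion_of_flip Φ ι₁ hδ hδ0 d hd0 hdneg ε ε' hTfin (fun v hv => hoff v (by simpa [hTdef] using hv))
    (flip_hypotheses_of_ne_on (d : maximalRealSubfield L) ε ε' T hns (fun v hv => hon v hv)) hpar hadm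

end Literature.NumberTheory.Automorphic.Liu2021.RemD5

end
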